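import Summits.RiemannHypothesis.RiemannHypothesis.Theorems.UniversalFactorMediumBoxDefs

/-!
# The u-side evaluator of `H_0′` and the one-point linear-ray check (checker definitions)

Cell rh-split (C15 / S-dbn-1), seat rh-splitx-eng-5 g3.  DEFINITIONS only, extending the certified
u-side evaluator of `H_0` of `UniversalFactorMediumDefs.lean` / `UniversalFactorMediumBoxDefs.lean`
(route UniversalFactor, crux `MediumKernelNoGo`) by

* `cellZD`, `cellsLoopD`, `uTailD`, `derivErr`, `evalH0D` — the **u-side evaluator of
  `Re H_0′(x′) = −∫₀^∞ Φ(u) u sin(x′u) du`** at a rational `x′ ≥ 0`: the SAME Gauss–Legendre tables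
  `phiTab ∋ ρ_u W_j Φ_N(u_{cj})` multiplied by the rational nodes `u_{cj}`, imaginary instead of real
  parts of the rotations `e^{i x′ u}`, and the three error terms re-derived for the extra factor `u`
  (disc bound `× (U + R_u)`, theta tails `× U`, u-tail `∫_U^∞ uΦ ≤ 50 e^{10U − πe^{4U}}/(4πe^{4U} − 10)`
  via `u ≤ e^u`);
* `pointCheck`, `linRayCheckWith`, `linRayCheck` — the **one-point certificate check** of
  `Theorems/Splittings/LinearRayOnePoint.lean` (`(Re H_0(s))² < Q_a(s)(a Re H_0(s) − Re H_0′(s))`)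
  for every `a` of a box `[A₁/AD, A₂/AD]`, with `Q_a(s)` enclosed by the interval-weighted y-side sums
  of the medium-kernel engine (`osaSideSum/osaSideErr/osaTailBound`, weights `[e^{−a₂y}, e^{−a₁y}]`);
* the real mirror `cellGLD` used by the soundness file.

All functions are total computable functions on `ℤ` built on `NumericsMP` (`MI`, `MC`).
HONEST LABEL: machinery for refuting an RH-STRENGTHENING conjunct (the linear-factor ray); nothing here
bears on the truth of RH.
-/

set_option linter.dupNamespace false

namespace Summit.RiemannHypothesis.RiemannHypothesis.Theorems.Splittings.LinearRayOnePoint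

open Literature.Analysis.ValidatedNumerics Literature.Analysis.ValidatedNumerics.NumericsMP
open Summit.RiemannHypothesis.RiemannHypothesis.Theorems

/-! ## The u-side evaluator of `H_0′` -/

/-- The u-node `u_{cj} = (2c+1)ρ_u + ρ_u t_j` of a context, as a rational. [folklore] -/
def uNodeQ (C : UniversalFactor.OsaCtx) (c j : ℕ) : ℚ :=
  ((2 * c + 1) * C.rhoUn * UniversalFactor.osaGlS + C.rhoUn * UniversalFactor.osaNodes.getD j 0 : ℤ) /
    ((C.rhoUd * UniversalFactor.osaGlS : ℕ) : ℚ)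

/-- The u-weighted node sum of u-cell `c`: `acc + Σ_{j<n} phiTab[c*32+j] · u_{cj} · N_j` (an `MC`). [folklore] -/
def cellZD (C : UniversalFactor.OsaCtx) (NF : Array MC) (c : ℕ) : ℕ → MC → MC
  | 0, acc => acc
  | j + 1, acc =>
    let Nj := NF.getD j (MC.ofInt C.S 0)
    let t := C.phiTab.getD (c * 32 + j) (MI.ofInt C.S 0)
    let tu := MI.mul C.S t (MI.ofFrac C.S (uNodeQ C c j).num (uNodeQ C c j).den)
    cellZD C NF c j ⟨acc.re.add (MI.mul C.S tu Nj.re), acc.im.add (MI.mul C.S tu Nj.im)⟩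

/-- Outer loop over the u-cells (as `UniversalFactor.osaCellsLoop`), adding the IMAGINARY parts
`Im(P · Z_c)`. [folklore] -/
def cellsLoopD (C : UniversalFactor.OsaCtx) (NF : Array MC) (B2 : MC) : ℕ → MC → MI → MI
  | 0, _, acc => acc
  | fuel + 1, P, acc =>
    let Z := cellZD C NF (C.Cu - (fuel + 1)) 32 (MC.ofInt C.S 0)
    let im : MI := (MI.mul C.S P.re Z.im).add (MI.mul C.S P.im Z.re)
    cellsLoopD C NF B2 fuel (MC.mul C.S P B2) (acc.add im)

/-- Upper bound (scaled) of the u-weighted `u`-tail bound `50 e^{10U − πe^{4U}} / (4πe^{4U} − 10)`,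
using `4πe^{4U} − 10 ≥ 2` (valid for every `U ≥ 0`) in the denominator. [folklore] -/
def uTailD (S Kexp kexp : ℕ) (piI : MI) (U : ℚ) : Option ℤ :=
  match MI.exp S Kexp kexp (MI.ofFrac S (4 * U).num (4 * U).den) with
  | some e4 =>
    match MI.exp S Kexp kexp ((MI.ofFrac S (10 * U).num (10 * U).den).sub (MI.mul S piI e4)) with
    | some g => some (Numerics.cdiv ((g.mulInt 50).hi) 2)
    | none => none
  | none => none

/-- The two error constants of the `H_0′` evaluator (scaled, units `1/S`):
`errAD ≥ S · osaDefectQ(ρ_u, R_u) · (U + R_u) · Σ_c PhiMaj_c` (to be multiplied by `e^{x′R_u}`) and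
`errBD ≥ S · (2ρ_u U Σ_c T_N(2cρ_u) + tail_U′)`, `U = 2 Cu ρ_u`. [folklore] -/
def derivErr (C : UniversalFactor.OsaCtx) : Option (ℤ × ℤ) :=
  let ρ : ℚ := (C.rhoUn : ℚ) / C.rhoUd
  let R : ℚ := (C.RUn : ℚ) / C.RUd
  let U : ℚ := 2 * C.Cu * ρ
  match UniversalFactor.osaErrSums C.S C.Kexp C.kexp C.piI ρ R C.Nth C.Cu 0 (0, 0),
    uTailD C.S C.Kexp C.kexp C.piI U with
  | some (sm, st), some tu =>
    let dA : ℚ := UniversalFactor.osaDefectQ ρ R * sm * (U + R)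
    let dB : ℚ := 2 * ρ * U * st
    some (Numerics.cdiv dA.num dA.den + 1, Numerics.cdiv dB.num dB.den + tu + 1)
  | _, _ => none

/-- **The u-side evaluator of `Re H_0′(x′)`**, `x′ = xn/xd ≥ 0` (`xd > 0`): minus the u-weighted
Gauss–Legendre sine sums over the u-cells, widened by `e^{x′R_u} · errAD + errBD`. [folklore] -/
def evalH0D (C : UniversalFactor.OsaCtx) (xn xd : ℕ) : Option MI :=
  match MC.expI C.S C.Kexp C.kexp C.piI (MI.ofFrac C.S ((xn : ℤ) * C.rhoUn) (xd * C.rhoUd)),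
    UniversalFactor.osaNodeFactors C xn xd 32,
    MI.exp C.S C.Kexp C.kexp (MI.ofFrac C.S ((xn : ℤ) * C.RUn) (xd * C.RUd)), derivErr C with
  | some B, some NF, some E, some (eA, eB) =>
    let B2 := MC.mul C.S B B
    let s := cellsLoopD C NF B2 C.Cu B (MI.ofInt C.S 0)
    let e : ℤ := Numerics.cdiv (E.hi * eA) C.S + eB
    if 0 ≤ E.hi ∧ 0 ≤ eA then some ((MI.neg s).widen e) else none
  | _, _, _, _ => none

/-! ## The one-point check -/

/-- **The one-point check** at the point `pt` (only `xn/xd`, the y-rule and `CyF` are used) for the box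
`[A₁/AD, A₂/AD]`, given enclosures `hx ∋ Re H_0(x)`, `hpx ∋ Re H_0′(x)` and the forward node values:
`(K Re H_0)².hi < (K Q · (a·K Re H_0 − K Re H_0′)).lo` in exact interval arithmetic (`K = 2^sc` a common
scale lifting the three tiny numbers above the fixed-point resolution `1/S`; the inequality is homogeneous),
`Q` the interval-weighted y-sum widened by its quadrature and tail errors. [folklore] -/
def pointCheck (C : UniversalFactor.OsaCtx) (pt : UniversalFactor.OsaPoint) (hx hpx : MI)
    (valsF : Array MI) (A₁ A₂ AD sc : ℕ) : Bool :=
  let dS : ℤ := UniversalFactor.osaCeilQ C.S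
    (UniversalFactor.osaDefectQ ((pt.rhoYn : ℚ) / pt.rhoYd) ((pt.RYn : ℚ) / pt.RYd))
  match UniversalFactor.osaWTabs C pt A₁ A₂ AD pt.CyF,
    UniversalFactor.osaSideErr C pt A₁ A₂ AD dS pt.CyF 0 0, UniversalFactor.osaTailBound C pt A₁ AD pt.CyF with
  | some WF, some eQ, some tQ =>
    let K : ℤ := 2 ^ sc
    let Qs : MI := UniversalFactor.osaSideSum C pt valsF WF (32 * pt.CyF) 0 (MI.ofInt C.S 0)
    let QK : MI := MI.mulInt ⟨Qs.lo - (eQ + tQ), Qs.hi + (eQ + tQ)⟩ K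
    let hK : MI := MI.mulInt hx K
    let hpK : MI := MI.mulInt hpx K
    let aI : MI := MI.span (MI.ofFrac C.S (A₁ : ℤ) AD) (MI.ofFrac C.S (A₂ : ℤ) AD)
    let T : MI := (MI.mul C.S aI hK).sub hpK
    decide ((MI.sqr C.S hK).hi < (MI.mul C.S QK T).lo)
  | _, _, _ => false

/-- The one-point check with a given evaluator context: context sanity (`0 < ρ_u < R_u ≤ 1/4`,
`1 ≤ N`, table size), point sanity, `0 < A₁`, `0 < AD`, and the point check (scale `2^sc`) on the evaluated data.
(The context is a PARAMETER so that no proof has to evaluate the closed term by kernel reduction.) [folklore] -/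
def linRayCheckWith (oc : Option UniversalFactor.OsaCtx) (pt : UniversalFactor.OsaPoint) (A₁ A₂ AD sc : ℕ) : Bool :=
  match oc with
  | none => false
  | some C =>
    decide (0 < AD ∧ 0 < A₁ ∧ 0 < C.rhoUn ∧ 0 < C.rhoUd ∧ 0 < C.RUd ∧ 4 * C.RUn ≤ C.RUd ∧
        C.rhoUn * C.RUd < C.RUn * C.rhoUd ∧ 1 ≤ C.Nth ∧ C.phiTab.size = 32 * C.Cu) &&
      pt.ok &&
      match UniversalFactor.osaH0 C pt.xn pt.xd, evalH0D C pt.xn pt.xd,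
        UniversalFactor.osaNodeVals C pt false (32 * pt.CyF) 0 #[] with
      | some hx, some hpx, some vF => pointCheck C pt hx hpx vF A₁ A₂ AD sc
      | _, _, _ => false

/-- The one-point check with the low-window context of the medium-kernel engine
(`mkOsaCtx 256 90 64 20 3 400 1 10 64 6`: 256-bit intervals, `ρ_u = 3/400`, `R_u = 1/10`, `Cu = 64`,
`N = 6`). [folklore] -/
def linRayCheck (pt : UniversalFactor.OsaPoint) (A₁ A₂ AD sc : ℕ) : Bool :=
  linRayCheckWith (UniversalFactor.mkOsaCtx 256 90 64 20 3 400 1 10 64 6) pt A₁ A₂ AD sc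

/-! ## Real-valued mirror used by the soundness statements -/

/-- The u-weighted Gauss–Legendre SINE node sum of u-cell `c` for `−Re H_0′(x′)`:
`Σ_{j<32} ρW_j Φ_N(u_{cj}) u_{cj} sin(x′ u_{cj})`, `u_{cj} = (2c+1)ρ + ρ t_j`. [folklore] -/
noncomputable def cellGLD (N : ℕ) (ρ x' : ℝ) (c : ℕ) : ℝ :=
  ∑ j ∈ Finset.range 32, ρ * UniversalFactor.osaWeightR j *
    (UniversalFactor.osaPhiN N ((2 * c + 1) * ρ + ρ * UniversalFactor.osaNodeR j) *
      ((2 * c + 1) * ρ + ρ * UniversalFactor.osaNodeR j) *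
      Real.sin (x' * ((2 * c + 1) * ρ + ρ * UniversalFactor.osaNodeR j)))

/-- Anchor of this definitions file: the u-node is the real u-node. [folklore] -/
theorem uNodeQ_cast (C : UniversalFactor.OsaCtx) (hC : 0 < C.rhoUd) (c j : ℕ) :
    ((uNodeQ C c j : ℚ) : ℝ) = (2 * c + 1) * C.rho + C.rho * UniversalFactor.osaNodeR j := by
  unfold uNodeQ UniversalFactor.OsaCtx.rho UniversalFactor.osaNodeR UniversalFactor.osaGlS
  have h1 : (C.rhoUd : ℝ) ≠ 0 := by exact_mod_cast hC.ne'
  push_cast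
  field_simp

end Summit.RiemannHypothesis.RiemannHypothesis.Theorems.Splittings.LinearRayOnePoint
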